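import Literature.NumberTheory.LFunctions.WeilExplicitFormulaProofs
import Literature.NumberTheory.LFunctions.WeilExplicitProofs
import HarnessLib

/-!
# Continuity of the polarised Weil functional along bounded a.e.-convergent windows
(crux OddBartaFloor, line Sketch, stub polarContinuity)

Fix a Weil test function `g`. For window tests `h_m` (smooth, `tsupport h_m ⊆ [-a, a]`,
`‖h_m‖_∞ ≤ B`) converging almost everywhere to a bounded measurable `F` vanishing off `[-a, a]`,
`W(g ⋆ h̃_m) → W(g ⋆ F̃)`.

Proof, on the ZERO SIDE of the explicit formula. Both kernels `k = g ⋆ G̃` (`G = h_m` or `G = F`)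
are Weil tests (smooth compactly supported `g` convolved with a bounded compactly supported
function, `HasCompactSupport.contDiff_convolution_left`), so by the tree's explicit formula
(`explicit_formula_holds`) and the absolute convergence of the zero side for test functions
(`summable_norm_zeroSide`, `hasWeilZeroSide_tsum`) `W(k) = Σ'_ρ m(ρ) k̂(ρ)`. By Fubini
(`MeasureTheory.integral_convolution`) and `weilMellin_weilReflect_holds`,
`k̂(ρ) = ĝ(ρ) · conj Ĝ(1 - ρ̄)`; `ĥ_m(s) → F̂(s)` for every `s` by dominated convergence, and the
sums converge by Tannery's theorem (`tendsto_tsum_of_dominated_convergence`) against the summable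
majorant `m(ρ) · (C_g/(1+γ²)²) · vol([-a,a]) B e^{|a|/2}` (`norm_weilMellin_le_sq`,
`weilZeroSummable` via `summable_norm_zeroSide_of_le`). Elementary on top of the tree's explicit
formula (Bombieri 2000, Thm. 2). [folklore]
-/

set_option linter.dupNamespace false

noncomputable section

open Set MeasureTheory Filter Complex
open scoped Real Topology ComplexConjugate ArithmeticFunction.vonMangoldt ENNReal

namespace Summit.RiemannHypothesis.RiemannHypothesis.Theorems.OddBartaFloor

open Literature.NumberTheory.LFunctions

/-- The explicit formula as an absolutely convergent sum: `W(k) = Σ'_ρ m(ρ) k̂(ρ)` for a Weil test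
`k` (`explicit_formula_holds`, `hasWeilZeroSide_tsum`, `summable_norm_zeroSide`). [folklore] -/
private theorem polarContinuity_weilFunctional_eq_tsum {k : ℝ → ℂ} (hk : IsWeilTest k) :
    weilFunctional k = ∑' ρ : ZetaZeros.riemannZetaNontrivialZeros,
      (riemannZetaZeroOrder (ρ : ℂ) : ℂ) * weilMellin k ρ :=
  tendsto_nhds_unique (explicit_formula_holds hk) (hasWeilZeroSide_tsum (summable_norm_zeroSide hk))

/-- Multiplicativity `(g ⋆ h)^(s) = ĝ(s) ĥ(s)` whenever both weighted integrands
`u ↦ g(u) e^{(s-1/2)u}`, `u ↦ h(u) e^{(s-1/2)u}` are integrable (Fubini,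
`MeasureTheory.integral_convolution`; adapted from `weilMellin_weilConv_holds`). [folklore] -/
private theorem polarContinuity_weilMellin_weilConv {g h : ℝ → ℂ} (s : ℂ)
    (hG : Integrable fun u : ℝ => g u * cexp ((s - 1 / 2) * u))
    (hH : Integrable fun u : ℝ => h u * cexp ((s - 1 / 2) * u)) :
    weilMellin (weilConv g h) s = weilMellin g s * weilMellin h s := by
  unfold weilMellin
  set c : ℂ := s - 1 / 2 with hc
  set G : ℝ → ℂ := fun u ↦ g u * cexp (c * u) with hGd
  set H : ℝ → ℂ := fun u ↦ h u * cexp (c * u) with hHd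
  have key : ∀ t : ℝ, weilConv g h t * cexp (c * t) =
      convolution G H (ContinuousLinearMap.mul ℂ ℂ) volume t := by
    intro t
    rw [weilConv_apply, convolution_def, ← integral_mul_const]
    congr 1 with u
    simp only [hGd, hHd, ContinuousLinearMap.mul_apply']
    have he : cexp (c * t) = cexp (c * u) * cexp (c * ((t - u : ℝ) : ℂ)) := by
      rw [← Complex.exp_add]
      push_cast
      ring_nf
    rw [he]
    ring
  have hL : (∫ t : ℝ, weilConv g h t * cexp (c * t)) =
      ∫ t : ℝ, convolution G H (ContinuousLinearMap.mul ℂ ℂ) volume t :=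
    integral_congr_ae (Eventually.of_forall fun t ↦ key t)
  rw [hL, integral_convolution (ContinuousLinearMap.mul ℂ ℂ) hG hH, ContinuousLinearMap.mul_apply']

/-- Pointwise bound of the Mellin integrand of a window function: if `‖G‖ ≤ B`, `G = 0` off
`[-a, a]` and `|Re s - 1/2| ≤ A`, then `‖G(t) e^{(s-1/2)t}‖ ≤ 𝟙_{[-a,a]}(t) · B e^{A|a|}`.
[folklore] -/
private theorem polarContinuity_norm_integrand_le {a B A : ℝ} {G : ℝ → ℂ} (hGB : ∀ t, ‖G t‖ ≤ B)
    (hG0 : ∀ t, t ∉ Icc (-a) a → G t = 0) {s : ℂ} (hs : |s.re - 1 / 2| ≤ A) (t : ℝ) :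
    ‖G t * cexp ((s - 1 / 2) * t)‖ ≤
      (Icc (-a) a).indicator (fun _ => B * Real.exp (A * |a|)) t := by
  by_cases ht : t ∈ Icc (-a) a
  · rw [indicator_of_mem ht, norm_mul, Complex.norm_exp]
    have hre : ((s - 1 / 2) * (t : ℂ)).re = (s.re - 1 / 2) * t := by simp [sub_re, mul_re]
    rw [hre]
    have hB : 0 ≤ B := (norm_nonneg _).trans (hGB t)
    refine mul_le_mul (hGB t) (Real.exp_le_exp.2 ?_) (Real.exp_pos _).le hB
    have hta : |t| ≤ |a| :=
      abs_le.2 ⟨by linarith [ht.1, le_abs_self a], by linarith [ht.2, le_abs_self a]⟩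
    calc (s.re - 1 / 2) * t ≤ |(s.re - 1 / 2) * t| := le_abs_self _
      _ = |s.re - 1 / 2| * |t| := abs_mul _ _
      _ ≤ A * |a| := mul_le_mul hs hta (abs_nonneg _) ((abs_nonneg _).trans hs)
  · rw [indicator_of_notMem ht, hG0 t ht, zero_mul, norm_zero]

/-- The majorant `𝟙_{[-a,a]} · c` is integrable. [folklore] -/
private theorem polarContinuity_integrable_indicator (a c : ℝ) :
    Integrable fun t : ℝ => (Icc (-a) a).indicator (fun _ => c) t :=
  (integrable_indicator_iff measurableSet_Icc).2 (integrableOn_const measure_Icc_lt_top.ne)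

/-- Uniform strip bound for the transform of a window function: if `‖G‖ ≤ B`, `G = 0` off
`[-a, a]` and `|Re s - 1/2| ≤ A` then `‖Ĝ(s)‖ ≤ vol([-a,a]) · B e^{A|a|}`. [folklore] -/
private theorem polarContinuity_norm_weilMellin_le {a B A : ℝ} {G : ℝ → ℂ} (hGB : ∀ t, ‖G t‖ ≤ B)
    (hG0 : ∀ t, t ∉ Icc (-a) a → G t = 0) {s : ℂ} (hs : |s.re - 1 / 2| ≤ A) :
    ‖weilMellin G s‖ ≤ (volume : Measure ℝ).real (Icc (-a) a) * (B * Real.exp (A * |a|)) := by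
  unfold weilMellin
  calc ‖∫ t : ℝ, G t * cexp ((s - 1 / 2) * t)‖ ≤ ∫ t : ℝ, ‖G t * cexp ((s - 1 / 2) * t)‖ :=
        norm_integral_le_integral_norm _
    _ ≤ ∫ t : ℝ, (Icc (-a) a).indicator (fun _ => B * Real.exp (A * |a|)) t :=
        integral_mono_of_nonneg (Eventually.of_forall fun _ ↦ norm_nonneg _)
          (polarContinuity_integrable_indicator _ _)
          (Eventually.of_forall (polarContinuity_norm_integrand_le hGB hG0 hs))
    _ = _ := by rw [integral_indicator_const _ measurableSet_Icc, smul_eq_mul]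

/-- A measurable window function (`‖G‖ ≤ B`, `G = 0` off `[-a, a]`) is integrable. [folklore] -/
private theorem polarContinuity_integrable {a B : ℝ} {G : ℝ → ℂ} (hGm : Measurable G)
    (hGB : ∀ t, ‖G t‖ ≤ B) (hG0 : ∀ t, t ∉ Icc (-a) a → G t = 0) : Integrable G :=
  (Measure.integrableOn_of_bounded measure_Icc_lt_top.ne hGm.aestronglyMeasurable
    (Eventually.of_forall hGB)).integrable_of_forall_notMem_eq_zero hG0

/-- The weighted Mellin integrand of a measurable window function is integrable. [folklore] -/
private theorem polarContinuity_integrable_integrand {a B : ℝ} {G : ℝ → ℂ} (hGm : Measurable G)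
    (hGB : ∀ t, ‖G t‖ ≤ B) (hG0 : ∀ t, t ∉ Icc (-a) a → G t = 0) (c : ℂ) :
    Integrable fun u : ℝ => G u * cexp (c * u) := by
  refine IntegrableOn.integrable_of_forall_notMem_eq_zero (s := Icc (-a) a) ?_ fun t ht ↦ by
    rw [hG0 t ht, zero_mul]
  exact (polarContinuity_integrable hGm hGB hG0).integrableOn.mul_continuousOn
    (by fun_prop : Continuous fun u : ℝ => cexp (c * u)).continuousOn isCompact_Icc

/-- The kernel `g ⋆ G` of a Weil test `g` against a measurable window function `G` is a Weil
test (`HasCompactSupport.contDiff_convolution_left`, `HasCompactSupport.convolution`).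
[folklore] -/
private theorem polarContinuity_isWeilTest_kernel {a B : ℝ} {g G : ℝ → ℂ} (hg : IsWeilTest g)
    (hGm : Measurable G) (hGB : ∀ t, ‖G t‖ ≤ B) (hG0 : ∀ t, t ∉ Icc (-a) a → G t = 0) :
    IsWeilTest (weilConv g G) := by
  rw [weilConv_eq_convolution_real]
  exact ⟨hg.2.contDiff_convolution_left (ContinuousLinearMap.mul ℝ ℂ) hg.1
      (polarContinuity_integrable hGm hGB hG0).locallyIntegrable,
    HasCompactSupport.convolution (L := ContinuousLinearMap.mul ℝ ℂ) hg.2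
      (HasCompactSupport.intro isCompact_Icc hG0)⟩

/-- Dominated convergence for the transforms of the windows: `ĥ_m(s) → F̂(s)` for every `s`.
[folklore] -/
private theorem polarContinuity_tendsto_weilMellin {a B : ℝ} {F : ℝ → ℂ} {h : ℕ → ℝ → ℂ}
    (hh : ∀ m, IsWeilTest (h m) ∧ tsupport (h m) ⊆ Icc (-a) a) (hhB : ∀ m t, ‖h m t‖ ≤ B)
    (hlim : ∀ᵐ t : ℝ, Tendsto (fun m => h m t) atTop (𝓝 (F t))) (s : ℂ) :
    Tendsto (fun m => weilMellin (h m) s) atTop (𝓝 (weilMellin F s)) := by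
  have h0 : ∀ m t, t ∉ Icc (-a) a → h m t = 0 := fun m t ht ↦
    image_eq_zero_of_notMem_tsupport fun h' ↦ ht ((hh m).2 h')
  unfold weilMellin
  exact tendsto_integral_of_dominated_convergence
    (F := fun m t => h m t * cexp ((s - 1 / 2) * t))
    (fun t => (Icc (-a) a).indicator (fun _ => B * Real.exp (|s.re - 1 / 2| * |a|)) t)
    (fun m ↦ ((hh m).1.1.continuous.mul (by fun_prop)).aestronglyMeasurable)
    (polarContinuity_integrable_indicator _ _)
    (fun m ↦ Eventually.of_forall (polarContinuity_norm_integrand_le (hhB m) (h0 m) le_rfl))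
    (hlim.mono fun t ht ↦ ht.mul_const _)

/-- **Continuity of the polarised Weil functional** `h ↦ W(g ⋆ h̃)` for a fixed Weil test `g`,
along window tests `h_m → F` a.e. with a common sup bound `B` and common support `[-a, a]`
(`F` bounded measurable, vanishing off `[-a, a]`): `W(g ⋆ h̃_m) → W(g ⋆ F̃)`. Zero side of the
explicit formula plus Tannery's theorem; see the module docstring. [folklore] -/
theorem stub_polarContinuity :
    ∀ (a B : ℝ) (g : ℝ → ℂ) (F : ℝ → ℂ) (h : ℕ → ℝ → ℂ),
      IsWeilTest g → Measurable F → (∀ t, ‖F t‖ ≤ B) → (∀ t, t ∉ Icc (-a) a → F t = 0) →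
      (∀ m, IsWeilTest (h m) ∧ tsupport (h m) ⊆ Icc (-a) a) → (∀ m t, ‖h m t‖ ≤ B) →
      (∀ᵐ t : ℝ, Tendsto (fun m => h m t) atTop (𝓝 (F t))) →
      Tendsto (fun m => weilFunctional (weilConv g (weilReflect (h m)))) atTop
        (𝓝 (weilFunctional (weilConv g (weilReflect F)))) := by
  intro a B g F h hg hFm hFB hF0 hh hhB hlim
  have hB : 0 ≤ B := (norm_nonneg _).trans (hFB 0)
  have h0 : ∀ m t, t ∉ Icc (-a) a → h m t = 0 := fun m t ht ↦
    image_eq_zero_of_notMem_tsupport fun h' ↦ ht ((hh m).2 h')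
  -- the reflected probe `F̃` is a measurable window function
  have hRm : Measurable (weilReflect F) :=
    Complex.continuous_conj.measurable.comp (hFm.comp measurable_neg)
  have hRB : ∀ t, ‖weilReflect F t‖ ≤ B := fun t ↦ by
    rw [weilReflect, Complex.norm_conj]
    exact hFB _
  have hR0 : ∀ t, t ∉ Icc (-a) a → weilReflect F t = 0 := fun t ht ↦ by
    rw [weilReflect, hF0 (-t) fun h' ↦ ht ⟨by linarith [h'.2], by linarith [h'.1]⟩, map_zero]
  -- the kernels are Weil tests, so `W = Σ'_ρ` for them
  have hkm : ∀ m, IsWeilTest (weilConv g (weilReflect (h m))) := fun m ↦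
    hg.weilConv (hh m).1.weilReflect
  have hkF : IsWeilTest (weilConv g (weilReflect F)) :=
    polarContinuity_isWeilTest_kernel hg hRm hRB hR0
  -- their transforms
  have hMm : ∀ m (s : ℂ), weilMellin (weilConv g (weilReflect (h m))) s =
      weilMellin g s * conj (weilMellin (h m) (1 - conj s)) := fun m s ↦ by
    rw [weilMellin_weilConv_holds hg.1.continuous hg.2 (hh m).1.weilReflect.1.continuous
      (hh m).1.weilReflect.2, weilMellin_weilReflect_holds]
  have hMF : ∀ s : ℂ, weilMellin (weilConv g (weilReflect F)) s =
      weilMellin g s * conj (weilMellin F (1 - conj s)) := fun s ↦ by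
    rw [polarContinuity_weilMellin_weilConv s (integrable_weilIntegrand hg.1.continuous hg.2 s)
      (polarContinuity_integrable_integrand hRm hRB hR0 _), weilMellin_weilReflect_holds]
  -- the summable majorant
  set C : ℝ := (volume : Measure ℝ).real (Icc (-a) a) * (B * Real.exp (1 / 2 * |a|)) with hC
  set K : ℝ := weilDecayW2 (1 / 2) g * C with hK
  have hC0 : 0 ≤ C := mul_nonneg measureReal_nonneg (mul_nonneg hB (Real.exp_pos _).le)
  have hK0 : 0 ≤ K := mul_nonneg (weilDecayW2_nonneg _ _) hC0
  have hstrip : ∀ ρ : ZetaZeros.riemannZetaNontrivialZeros, |(ρ : ℂ).re - 1 / 2| ≤ 1 / 2 ∧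
      |(1 - conj (ρ : ℂ)).re - 1 / 2| ≤ 1 / 2 := fun ρ ↦ by
    have h1 := ZetaZeros.riemannZetaNontrivialZeros.re_pos ρ.2
    have h2 := ZetaZeros.riemannZetaNontrivialZeros.re_lt_one ρ.2
    simp only [sub_re, one_re, conj_re]
    exact ⟨abs_le.2 ⟨by linarith, by linarith⟩, abs_le.2 ⟨by linarith, by linarith⟩⟩
  have key : Tendsto (fun m ↦ ∑' ρ : ZetaZeros.riemannZetaNontrivialZeros,
      (riemannZetaZeroOrder (ρ : ℂ) : ℂ) * weilMellin (weilConv g (weilReflect (h m))) ρ) atTop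
      (𝓝 (∑' ρ : ZetaZeros.riemannZetaNontrivialZeros,
        (riemannZetaZeroOrder (ρ : ℂ) : ℂ) * weilMellin (weilConv g (weilReflect F)) ρ)) := by
    refine tendsto_tsum_of_dominated_convergence
      (bound := fun ρ : ZetaZeros.riemannZetaNontrivialZeros ↦
        ‖(riemannZetaZeroOrder (ρ : ℂ) : ℂ) * ((K / (1 + (ρ : ℂ).im ^ 2) ^ 2 : ℝ) : ℂ)‖)
      (summable_norm_zeroSide_of_le (a := fun z : ℂ ↦ ((K / (1 + z.im ^ 2) ^ 2 : ℝ) : ℂ))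
        (K := K) fun ρ _ ↦ ?_) (fun ρ ↦ ?_) (Eventually.of_forall fun m ρ ↦ ?_)
    · rw [Complex.norm_real, Real.norm_eq_abs, abs_of_nonneg (div_nonneg hK0 (by positivity))]
    · simp only [hMm, hMF]
      exact (((Complex.continuous_conj.tendsto _).comp (polarContinuity_tendsto_weilMellin
        hh hhB hlim (1 - conj (ρ : ℂ)))).const_mul _).const_mul _
    · rw [norm_mul, norm_mul, Complex.norm_real, Real.norm_eq_abs,
        abs_of_nonneg (div_nonneg hK0 (by positivity)), hMm, norm_mul, Complex.norm_conj]
      refine mul_le_mul_of_nonneg_left ?_ (norm_nonneg _)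
      have e1 : ‖weilMellin g ρ‖ ≤ weilDecayW2 (1 / 2) g / (1 + (ρ : ℂ).im ^ 2) ^ 2 :=
        norm_weilMellin_le_sq hg (hstrip ρ).1
      have e2 : ‖weilMellin (h m) (1 - conj (ρ : ℂ))‖ ≤ C :=
        polarContinuity_norm_weilMellin_le (hhB m) (h0 m) (hstrip ρ).2
      calc ‖weilMellin g ρ‖ * ‖weilMellin (h m) (1 - conj (ρ : ℂ))‖
          ≤ weilDecayW2 (1 / 2) g / (1 + (ρ : ℂ).im ^ 2) ^ 2 * C :=
            mul_le_mul e1 e2 (norm_nonneg _) (div_nonneg (weilDecayW2_nonneg _ _) (by positivity))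
        _ = K / (1 + (ρ : ℂ).im ^ 2) ^ 2 := by rw [hK]; ring
  rw [polarContinuity_weilFunctional_eq_tsum hkF]
  exact key.congr fun m ↦ (polarContinuity_weilFunctional_eq_tsum (hkm m)).symm

end Summit.RiemannHypothesis.RiemannHypothesis.Theorems.OddBartaFloor

end
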